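import Summits.RiemannHypothesis.RiemannHypothesis.Theses.WeilComb
import Summits.RiemannHypothesis.RiemannHypothesis.Theorems.WeilCombCombShapePositivityFejerOfCrux
import Summits.RiemannHypothesis.RiemannHypothesis.Theorems.WeilCombCombShapePositivityStubFejerConvSquare
import Summits.RiemannHypothesis.RiemannHypothesis.Theorems.WeilCombCombShapePositivityEffectiveWindow
import Summits.RiemannHypothesis.RiemannHypothesis.Theorems.WeilCombCombShapeDetection
import Literature.NumberTheory.LFunctions.WeilCriterionConverse
import Mathlib.Topology.Algebra.Order.Archimedean

/-!
# Sketch (stub-ideation k3, FAMILY 3 — probe the extremes) for `stub_fejer` of line `Sketch`,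
crux `WeilComb.CombShapePositivity` (stmt-RiemannHypothesis-11229).

Helper-lemma STATEMENTS only (each `sorry`), elaboration check. Abbreviations `bump`, `sym`, `chi`,
`face`, `combQ` are file-local and definitionally equal to the verbatim sub-expressions of the
registered stub (`face_eq_stub` is `rfl`).
-/

noncomputable section

set_option linter.dupNamespace false

open scoped BigOperators ComplexConjugate
open Complex

namespace Summit.RiemannHypothesis.RiemannHypothesis.Cruxes.CombShapePositivity.StubFejerK3

open Literature.NumberTheory.LFunctions
open Summit.RiemannHypothesis.RiemannHypothesis.Theses.WeilComb

/-- `φ_ε(t) = ε⁻¹ φ₀(t/ε)`, `φ₀(u) = expNegInvGlue (1 - u²)` (verbatim sub-expression of the stub). -/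
def bump (ε : ℝ) : ℝ → ℂ := fun t : ℝ => (ε : ℂ)⁻¹ * ((expNegInvGlue (1 - (t / ε) ^ 2) : ℝ) : ℂ)

/-- comb symbol `w_ε(x) = W(τ_x (φ_ε ⋆ φ̃_ε))`. -/
def sym (ε x : ℝ) : ℂ := weilFunctional (weilTranslate (weilConv (bump ε) (weilReflect (bump ε))) x)

/-- Bohr character `χ_θ(d) = exp(i Σ_{p∈S} θ_p v_p(d))`. -/
def chi (S : Finset ℕ) (θ : ℕ → ℝ) (d : ℕ) : ℂ :=
  Complex.exp (I * ((∑ p ∈ S, θ p * (d.factorization p : ℝ) : ℝ) : ℂ))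

/-- the Fejér face `Re P(ε, S, n, θ)` = the quantity `stub_fejer` asserts is `≥ 0`. -/
def face (ε : ℝ) (S : Finset ℕ) (n : ℕ) (θ : ℕ → ℝ) : ℝ :=
  (∑ d ∈ (∏ p ∈ S, p ^ n).divisors, ∑ d' ∈ (∏ p ∈ S, p ^ n).divisors,
    chi S θ d * conj (chi S θ d') * sym ε (Real.log (d : ℝ) - Real.log (d' : ℝ))).re

/-- the crux cell `Re Q(comb ε M a)`. -/
def combQ (ε : ℝ) (M : ℕ) (a : ℕ → ℂ) : ℝ :=
  (weilQuadratic (fun x : ℝ => ∑ m ∈ Finset.Icc 1 M,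
    a m * ((ε : ℂ)⁻¹ * ((expNegInvGlue (1 - ((x - Real.log (m : ℝ)) / ε) ^ 2) : ℝ) : ℂ)))).re

/-- faithfulness: `face` is the stub's left-hand side, by `rfl`. -/
theorem face_eq_stub (ε : ℝ) (S : Finset ℕ) (n : ℕ) (θ : ℕ → ℝ) :
    face ε S n θ =
      (∑ d ∈ (∏ p ∈ S, p ^ n).divisors, ∑ d' ∈ (∏ p ∈ S, p ^ n).divisors,
        Complex.exp (I * ((∑ p ∈ S, θ p * (d.factorization p : ℝ) : ℝ) : ℂ)) *
          conj (Complex.exp (I * ((∑ p ∈ S, θ p * (d'.factorization p : ℝ) : ℝ) : ℂ))) *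
          weilFunctional (weilTranslate
            (weilConv (fun t : ℝ => (ε : ℂ)⁻¹ * ((expNegInvGlue (1 - (t / ε) ^ 2) : ℝ) : ℂ))
              (weilReflect (fun t : ℝ => (ε : ℂ)⁻¹ * ((expNegInvGlue (1 - (t / ε) ^ 2) : ℝ) : ℂ))))
            (Real.log (d : ℝ) - Real.log (d' : ℝ)))).re := rfl

/-- stub_fejer restated through the abbreviations (the target; ≡ RH, `fejer_iff_riemannHypothesis`). -/
theorem stub_fejer_restated :
    (∀ ε : ℝ, 0 < ε → ∀ S : Finset ℕ, (∀ p ∈ S, p.Prime) → ∀ (n : ℕ) (θ : ℕ → ℝ), 0 ≤ face ε S n θ)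
      ↔ RiemannHypothesis :=
  Summit.RiemannHypothesis.RiemannHypothesis.Theorems.WeilCombFejerConvSquare.fejer_iff_riemannHypothesis

/-! ## H1 — the window face is a theorem NOW (perturbation from the proved neighbour) -/

/-- H1: explicit unconditional corner `ε·∏p^n ≤ 1/128 ⇒ face ≥ 0`
(`fejer_of_cell` + `WeilCombBohrFejer.stub_windowSub`, p103822). Upgrade `1/128 → 1/40` when
`…EffectiveWindow40` lands, `→ M/(2(M+1))` when `stub_windowCore` does. -/
theorem H1_face_window : ∀ ε : ℝ, 0 < ε → ∀ S : Finset ℕ, (∀ p ∈ S, p.Prime) → ∀ (n : ℕ) (θ : ℕ → ℝ),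
    ε * ((∏ p ∈ S, p ^ n : ℕ) : ℝ) ≤ 1 / 128 → 0 ≤ face ε S n θ := by
  intro ε hε S hS n θ h
  exact Summit.RiemannHypothesis.RiemannHypothesis.Theorems.WeilCombBohrFejer.fejer_of_cell hε hS n θ
    (fun a => Summit.RiemannHypothesis.RiemannHypothesis.Theorems.WeilCombBohrFejer.stub_windowSub ε hε _ a h)

/-! ## H2 — minimal counterexample: the two-prime torus is the whole stub (at each fixed ε) -/

/-- H2a: S-LOCAL product-vector reduction for an ARBITRARY kernel `w` (generalises the landed
`stub_reduction`, whose proof uses `S ⊇ primeFactors` only through the support of the nodes). -/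
theorem H2a_reduction_local (w : ℝ → ℂ) (S : Finset ℕ) (hS : ∀ p ∈ S, p.Prime)
    (hbox : ∀ (n : ℕ) (θ : ℕ → ℝ),
      0 ≤ (∑ d ∈ (∏ p ∈ S, p ^ n).divisors, ∑ d' ∈ (∏ p ∈ S, p ^ n).divisors,
        chi S θ d * conj (chi S θ d') * w (Real.log (d : ℝ) - Real.log (d' : ℝ))).re)
    (T : Finset ℕ) (hT : ∀ m ∈ T, m ≠ 0 ∧ m.primeFactors ⊆ S) (c : ℕ → ℂ) :
    0 ≤ (∑ m ∈ T, ∑ m' ∈ T, c m * conj (c m') * w (Real.log (m : ℝ) - Real.log (m' : ℝ))).re := by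
  sorry

/-- H2b: `ℤ log p + ℤ log q` is dense in `ℝ` for distinct primes (Mathlib `AddSubgroup.dense_or_cyclic`
+ `p^b ≠ q^a` unless `a = b = 0`). -/
theorem H2b_dense_two_logs {p q : ℕ} (hp : p.Prime) (hq : q.Prime) (hpq : p ≠ q) :
    Dense ((AddSubgroup.closure ({Real.log (p : ℝ), Real.log (q : ℝ)} : Set ℝ) : AddSubgroup ℝ) : Set ℝ) := by
  sorry

/-- H2c: the comb symbol on the ZERO SIDE: `w_ε(x) = B_{φ_ε}(x) = Σ_ρ m(ρ) P_{φ_ε}(ρ) e^{(ρ−1/2)x}`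
(`explicit_formula_holds` for `τ_x ψ_ε`, `weilMellin_weilTranslate`, `weilMellin_weilQuadratic`,
`hasWeilZeroSide_tsum`, uniqueness of limits). -/
theorem H2c_sym_eq_expSum : ∀ ε : ℝ, 0 < ε → ∀ x : ℝ, sym ε x = WeilConverse.expSum (bump ε) x := by
  sorry

/-- H2c': hence the symbol is continuous (`combShapeDetection_continuous_expSum`). -/
theorem H2c'_continuous_sym : ∀ ε : ℝ, 0 < ε → Continuous (sym ε) := by
  intro ε hε
  have e : sym ε = WeilConverse.expSum (bump ε) := funext (H2c_sym_eq_expSum ε hε)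
  rw [e]
  exact Summit.RiemannHypothesis.RiemannHypothesis.Theorems.combShapeDetection_continuous_expSum
    (Summit.RiemannHypothesis.RiemannHypothesis.Theorems.combShapeDetection_shapeBump_isWeilTest ε)

/-- H2d: positive-semidefiniteness of the node forms of a CONTINUOUS kernel passes from nodes in a
dense additive subgroup to arbitrary real nodes (closed superlevel set ⊇ dense set). -/
theorem H2d_psd_of_dense {w : ℝ → ℂ} (hw : Continuous w) {G : AddSubgroup ℝ} (hG : Dense (G : Set ℝ))
    (hpos : ∀ (k : ℕ) (x : Fin k → ℝ) (c : Fin k → ℂ), (∀ i, x i ∈ G) →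
      0 ≤ (∑ i, ∑ j, c i * conj (c j) * w (x i - x j)).re)
    {ι : Type*} (T : Finset ι) (x : ι → ℝ) (c : ι → ℂ) :
    0 ≤ (∑ i ∈ T, ∑ j ∈ T, c i * conj (c j) * w (x i - x j)).re := by
  sorry

/-- H2: TWO-PRIME COLLAPSE at fixed `ε`: the Fejér face on ONE two-prime torus (all `n`, `θ`) already gives
the whole crux cell-family at that `ε` (H2a with `S = {p,q}` and `w = sym ε`, shift lattice nodes into `ℕ`,
H2b + H2c' + H2d, Gram identity `weilQuadratic_nodeComb_eq_sum` / `stub_gram`). -/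
theorem H2_crux_of_face_two_primes : ∀ ε : ℝ, 0 < ε → ∀ p q : ℕ, p.Prime → q.Prime → p ≠ q →
    (∀ (n : ℕ) (θ : ℕ → ℝ), 0 ≤ face ε {p, q} n θ) → ∀ (M : ℕ) (a : ℕ → ℂ), 0 ≤ combQ ε M a := by
  sorry

/-- H2e: the sharpest Bohr-coordinate form of the equivalence — RH ⟺ Fejér positivity over `2^a 3^b` only. -/
theorem H2e_riemannHypothesis_iff_face_two_three :
    RiemannHypothesis ↔ ∀ ε : ℝ, 0 < ε → ∀ (n : ℕ) (θ : ℕ → ℝ), 0 ≤ face ε {2, 3} n θ := by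
  constructor
  · intro hRH ε hε n θ
    exact Summit.RiemannHypothesis.RiemannHypothesis.Theorems.WeilCombBohrFejer.fejer_of_riemannHypothesis
      hRH ε hε {2, 3} (fun p hp => by
        simp only [Finset.mem_insert, Finset.mem_singleton] at hp
        rcases hp with rfl | rfl <;> norm_num) n θ
  · intro h
    have hPos : CombShapePositivity := fun ε hε M a =>
      H2_crux_of_face_two_primes ε hε 2 3 Nat.prime_two Nat.prime_three (by norm_num) (h ε hε) M a
    exact (Summit.RiemannHypothesis.RiemannHypothesis.Theorems.weilComb_combShapePositivity_iff_riemannHypothesis_of_detection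
      Summit.RiemannHypothesis.RiemannHypothesis.Theorems.combShapeDetection_proof).mp hPos

/-! ## H3 — faces are downward hereditary in `S` (average out one angle): failing is an up-set -/

theorem H3_face_erase : ∀ ε : ℝ, 0 < ε → ∀ S : Finset ℕ, (∀ p ∈ S, p.Prime) → ∀ q ∈ S,
    ∀ (n : ℕ) (θ : ℕ → ℝ), (∀ t : ℝ, 0 ≤ face ε S n (Function.update θ q t)) →
      0 ≤ face ε (S.erase q) n θ := by
  sorry

/-! ## H4 — mechanism / extremal configuration: Euler-product factorisation of the divisor comb -/

/-- H4: `Ĝ(s) = φ̂_ε(s) · ∏_{p∈S} Σ_{j≤n} e^{ijθ_p} p^{j(s−1/2)}` for the divisor-box comb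
`G = Σ_{d∣N} χ_θ(d) φ_ε(· − log d)`; on `Re s = 1/2` each factor is a Dirichlet kernel at
`θ_p + γ log p`, so under RH `face = Σ_γ m_γ |φ̂_ε|² ∏_p |D_n(θ_p + γ log p)|²` (Fejér kernels riding the
Kronecker flow) — the extremal `θ` avoids the orbit points of the heavy zeros. -/
theorem H4_weilMellin_divisorComb : ∀ ε : ℝ, 0 < ε → ∀ S : Finset ℕ, (∀ p ∈ S, p.Prime) →
    ∀ (n : ℕ) (θ : ℕ → ℝ) (s : ℂ),
      weilMellin (fun x : ℝ => ∑ d ∈ (∏ p ∈ S, p ^ n).divisors, chi S θ d * bump ε (x - Real.log (d : ℝ))) s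
        = weilMellin (bump ε) s *
          ∏ p ∈ S, ∑ j ∈ Finset.range (n + 1),
            Complex.exp (I * ((θ p * j : ℝ) : ℂ)) * Complex.exp ((s - 1 / 2) * (j * Real.log (p : ℝ) : ℝ)) := by
  sorry

end Summit.RiemannHypothesis.RiemannHypothesis.Cruxes.CombShapePositivity.StubFejerK3

end
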